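import Mathlib
import HarnessLib
import Summits.RiemannHypothesis.RiemannHypothesis.Theorems.IntegerScrewMarkovTransfer
import Summits.RiemannHypothesis.RiemannHypothesis.Theorems.IntegerScrewWalkGenerator
import Summits.RiemannHypothesis.RiemannHypothesis.Theorems.IntegerScrewWalkStates
import Summits.RiemannHypothesis.RiemannHypothesis.Theorems.IntegerScrewHarmonicStates

/-!
# Route `IntegerScrew` — THEOREM C♯'s SKELETON in the kernel: the walk's generator, the comparison functions
# `h̃`, `h′`, and «generator inequality ⇒ two-sided return law» (PIVOT-LAW 13.44 / CONTINUUM-LIMIT §16)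

This file pins down, against the tree's definitions, the exact logical shape of THEOREM C♯ (CONTINUUM-LIMIT
16.0–16.2): with `L = log M`,

* (from `IntegerScrewWalkGenerator`) `walkGen M` — the τ-time generator of PROP. N4's walk on `{1,…,M}` as a
  Metzler matrix, with its arithmetic form `walkGen_sum_eq_arith`;
* (from `IntegerScrewHarmonicStates`) `hTilde`, `hPrime` = 16.2's `h̃`, `h′` on the states, with their
  limits at `u = 0` and explicit `u`-derivatives `hTildeDeriv`, `hPrimeDeriv`;
* **`returnProb_le_of_generator_le` / `returnProb_ge_of_generator_ge`**: if for all `u > 0` and all states `z`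
  the generator inequality `(walkGen·h′(u))(z) − ∂_u h′(u;z) ≤ ε·h′(u;z)` holds (resp.
  `(walkGen·h̃(u))(z) − ∂_u h̃(u;z) ≥ −ε·h̃(u;z)`), then for every `τ > 0`
  `(e^{τ·walkGen M})_{11} ≤ e^{ετ} g(τ)` (resp. `≥ e^{−ετ} g(τ)`) — literally «With 16.1 this is THEOREM C♯»
  (the `u`-derivative is taken as a datum `D` with its `HasDerivAt` certificate, so that the remaining
  obligation is exactly the arithmetic bookkeeping 16.4–16.5, nothing else); and the same with the generator in
  ARITHMETIC form `Σ_{n≤M/x}Λ(n)/(nL)(g(xn) − g(x)) + Σ_{d∣x}Λ(d)/L(g(x/d) − g(x))` (`walkGen_sum_eq_arith`,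
  `returnProb_le_of_arith_generator_le` / `returnProb_ge_of_arith_generator_ge`) — 16.4's starting line;
  and finally with the explicit derivatives discharged (`returnProb_le_of_sixteen_four` /
  `returnProb_ge_of_sixteen_four`): **the ONLY hypothesis left is 16.4–16.5's generator inequality.**

Proof: the Markov transfer lemma (`IntegerScrewMarkovTransfer`) applied to `f(u;·) = h′(u + η;·)` on `[0,τ]`
for `η > 0`, then `η → 0⁺` using `K(u,r) → 1` (`IntegerScrewHarmonicK`).  RH-free; nothing here bears on
the truth of RH.  References: PIVOT-LAW §13.10 (PROP. N4), §13.44; CONTINUUM-LIMIT §16.0–16.2, §21 (rh-explicit);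
M. Suzuki, J. Lond. Math. Soc. (2) 108 (2023) 1448–1487 [Suzuki2023].
-/

noncomputable section

-- D-0017: `Summit.<S>.<S>.…` is the designed namespace of a single-problem summit.
set_option linter.dupNamespace false

namespace Summit.RiemannHypothesis.RiemannHypothesis.Theorems.IntegerScrew

open NormedSpace Finset Set Filter Topology ArithmeticFunction

/-! ## Generator inequality ⇒ return law (THEOREM C♯'s skeleton) -/

/-- The state `1 ∈ {1,…,M}`. -/
def stOne {M : ℕ} (hM : 1 ≤ M) : St M := ⟨1, Finset.mem_Icc.2 ⟨le_rfl, hM⟩⟩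

/-- The state `1` is the integer `1`. -/
@[simp] theorem coe_stOne {M : ℕ} (hM : 1 ≤ M) : ((stOne hM : St M) : ℕ) = 1 := rfl

/-- **THEOREM C♯, upper skeleton.**  If `D` is a `u`-derivative of `h′` on `u > 0` and the generator inequality
`Σ_y walkGen(z,y)·h′(u;y) − D(u;z) ≤ ε·h′(u;z)` holds for all `u > 0` and all states `z`, then for every `τ > 0`
the return probability satisfies `(e^{τ·walkGen M})_{11} ≤ e^{ετ}·g(τ)`. -/
theorem returnProb_le_of_generator_le {M : ℕ} (hM : 1 ≤ M) {τ ε : ℝ} (hτ : 0 < τ) (D : ℝ → ℕ → ℝ)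
    (hD : ∀ u, 0 < u → ∀ x : St M, HasDerivAt (fun v => hPrime (Real.log M) v x) (D u x) u)
    (hineq : ∀ u, 0 < u → ∀ z : St M,
      (∑ y : St M, walkGen M z y * hPrime (Real.log M) u y) - D u z ≤ ε * hPrime (Real.log M) u z) :
    (exp (τ • walkGen M)) (stOne hM) (stOne hM) ≤ Real.exp (ε * τ) * ccpg τ := by
  set L := Real.log M with hL
  -- for every η > 0: the shifted comparison
  have hstep : ∀ η : ℝ, 0 < η →
      ∑ y : St M, (exp (τ • walkGen M)) (stOne hM) y * hPrime L η y ≤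
        Real.exp (ε * τ) * hPrime L (τ + η) 1 := by
    intro η hη
    have h := markovTransfer_le (walkGen M) (walkGen_offdiag_nonneg M) (stOne hM)
      (fun u y => hPrime L (u + η) y) (fun u y => D (u + η) y) (τ := τ) (β := ε) hτ.le
      (fun y => ?_) (fun u hu y => ?_) (fun u hu z => ?_)
    · simpa only [zero_add, coe_stOne] using h
    · refine continuousOn_of_forall_continuousAt fun u hu => ?_
      have hpos : 0 < u + η := by have := hu.1; linarith
      have hd := (hD (u + η) hpos y).comp u ((hasDerivAt_id' u).add_const η)
      exact hd.continuousAt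
    · have hpos : 0 < u + η := by have := hu.1; linarith
      exact ((hD (u + η) hpos y).comp u ((hasDerivAt_id' u).add_const η)).congr_deriv (by ring)
    · have hpos : 0 < u + η := by have := hu.1; linarith
      exact hineq (u + η) hpos z
  -- η → 0⁺ on both sides
  have hlim_l : Tendsto (fun η => ∑ y : St M, (exp (τ • walkGen M)) (stOne hM) y * hPrime L η y)
      (𝓝[>] 0) (𝓝 ((exp (τ • walkGen M)) (stOne hM) (stOne hM))) := by
    have h1 : Tendsto (fun η => ∑ y : St M, (exp (τ • walkGen M)) (stOne hM) y * hPrime L η y)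
        (𝓝[>] 0) (𝓝 (∑ y : St M, (exp (τ • walkGen M)) (stOne hM) y * (if (y : ℕ) = 1 then 1 else 0))) := by
      refine tendsto_finsetSum _ fun y _ => ?_
      have hy : (y : ℕ) ≠ 0 := by have := (Finset.mem_Icc.1 y.2).1; omega
      exact (tendsto_hPrime_zero L hy).const_mul _
    have h2 : (∑ y : St M, (exp (τ • walkGen M)) (stOne hM) y * (if (y : ℕ) = 1 then (1 : ℝ) else 0)) =
        (exp (τ • walkGen M)) (stOne hM) (stOne hM) := by
      have h3 : ∀ y : St M, ((y : ℕ) = 1) = (y = stOne hM) := by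
        intro y
        apply propext
        constructor
        · intro h; exact Subtype.ext h
        · intro h; rw [h]; rfl
      simp_rw [h3, mul_ite, mul_one, mul_zero, Finset.sum_ite_eq', Finset.mem_univ, if_true]
    rw [h2] at h1
    exact h1
  have hlim_r : Tendsto (fun η => Real.exp (ε * τ) * hPrime L (τ + η) 1) (𝓝[>] 0)
      (𝓝 (Real.exp (ε * τ) * ccpg τ)) := by
    refine Tendsto.const_mul _ ?_
    simp_rw [hPrime_one]
    rw [← ccpK_one hτ.ne']
    have hc : ContinuousAt (fun v => ccpK v 1) τ := (hasDerivAt_ccpK hτ.ne' 1).continuousAt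
    have ht : Tendsto (fun η : ℝ => τ + η) (𝓝[>] 0) (𝓝 τ) := by
      have : Tendsto (fun η : ℝ => τ + η) (𝓝 0) (𝓝 (τ + 0)) :=
        (continuous_const.add continuous_id).tendsto 0
      rw [add_zero] at this
      exact this.mono_left nhdsWithin_le_nhds
    exact hc.tendsto.comp ht
  refine le_of_tendsto_of_tendsto hlim_l hlim_r ?_
  filter_upwards [self_mem_nhdsWithin] with η hη
  exact hstep η hη

/-- **THEOREM C♯, lower skeleton** (with `h̃` and the reversed generator inequality):
`(e^{τ·walkGen M})_{11} ≥ e^{−ετ}·g(τ)`. -/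
theorem returnProb_ge_of_generator_ge {M : ℕ} (hM : 1 ≤ M) {τ ε : ℝ} (hτ : 0 < τ) (D : ℝ → ℕ → ℝ)
    (hD : ∀ u, 0 < u → ∀ x : St M, HasDerivAt (fun v => hTilde (Real.log M) v x) (D u x) u)
    (hineq : ∀ u, 0 < u → ∀ z : St M,
      -(ε * hTilde (Real.log M) u z) ≤ (∑ y : St M, walkGen M z y * hTilde (Real.log M) u y) - D u z) :
    Real.exp (-(ε * τ)) * ccpg τ ≤ (exp (τ • walkGen M)) (stOne hM) (stOne hM) := by
  set L := Real.log M with hL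
  have hstep : ∀ η : ℝ, 0 < η →
      Real.exp (-(ε * τ)) * hTilde L (τ + η) 1 ≤
        ∑ y : St M, (exp (τ • walkGen M)) (stOne hM) y * hTilde L η y := by
    intro η hη
    have h := markovTransfer_ge (walkGen M) (walkGen_offdiag_nonneg M) (stOne hM)
      (fun u y => hTilde L (u + η) y) (fun u y => D (u + η) y) (τ := τ) (β := ε) hτ.le
      (fun y => ?_) (fun u hu y => ?_) (fun u hu z => ?_)
    · simpa only [zero_add, coe_stOne] using h
    · refine continuousOn_of_forall_continuousAt fun u hu => ?_
      have hpos : 0 < u + η := by have := hu.1; linarith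
      have hd := (hD (u + η) hpos y).comp u ((hasDerivAt_id' u).add_const η)
      exact hd.continuousAt
    · have hpos : 0 < u + η := by have := hu.1; linarith
      exact ((hD (u + η) hpos y).comp u ((hasDerivAt_id' u).add_const η)).congr_deriv (by ring)
    · have hpos : 0 < u + η := by have := hu.1; linarith
      exact hineq (u + η) hpos z
  have hlim_r : Tendsto (fun η => ∑ y : St M, (exp (τ • walkGen M)) (stOne hM) y * hTilde L η y)
      (𝓝[>] 0) (𝓝 ((exp (τ • walkGen M)) (stOne hM) (stOne hM))) := by
    have h1 : Tendsto (fun η => ∑ y : St M, (exp (τ • walkGen M)) (stOne hM) y * hTilde L η y)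
        (𝓝[>] 0) (𝓝 (∑ y : St M, (exp (τ • walkGen M)) (stOne hM) y * (if (y : ℕ) = 1 then 1 else 0))) := by
      refine tendsto_finsetSum _ fun y _ => ?_
      have hy : (y : ℕ) ≠ 0 := by have := (Finset.mem_Icc.1 y.2).1; omega
      exact (tendsto_hTilde_zero L hy).const_mul _
    have h2 : (∑ y : St M, (exp (τ • walkGen M)) (stOne hM) y * (if (y : ℕ) = 1 then (1 : ℝ) else 0)) =
        (exp (τ • walkGen M)) (stOne hM) (stOne hM) := by
      have h3 : ∀ y : St M, ((y : ℕ) = 1) = (y = stOne hM) := by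
        intro y
        apply propext
        constructor
        · intro h; exact Subtype.ext h
        · intro h; rw [h]; rfl
      simp_rw [h3, mul_ite, mul_one, mul_zero, Finset.sum_ite_eq', Finset.mem_univ, if_true]
    rw [h2] at h1
    exact h1
  have hlim_l : Tendsto (fun η => Real.exp (-(ε * τ)) * hTilde L (τ + η) 1) (𝓝[>] 0)
      (𝓝 (Real.exp (-(ε * τ)) * ccpg τ)) := by
    refine Tendsto.const_mul _ ?_
    simp_rw [hTilde_one]
    rw [← ccpK_one hτ.ne']
    have hc : ContinuousAt (fun v => ccpK v 1) τ := (hasDerivAt_ccpK hτ.ne' 1).continuousAt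
    have ht : Tendsto (fun η : ℝ => τ + η) (𝓝[>] 0) (𝓝 τ) := by
      have : Tendsto (fun η : ℝ => τ + η) (𝓝 0) (𝓝 (τ + 0)) :=
        (continuous_const.add continuous_id).tendsto 0
      rw [add_zero] at this
      exact this.mono_left nhdsWithin_le_nhds
    exact hc.tendsto.comp ht
  refine le_of_tendsto_of_tendsto hlim_l hlim_r ?_
  filter_upwards [self_mem_nhdsWithin] with η hη
  exact hstep η hη

/-! ## The same with the generator in arithmetic form (the starting line of CONTINUUM-LIMIT 16.4) -/

/-- **THEOREM C♯, upper skeleton, arithmetic form.**  The generator inequality is required in the form in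
which 16.4 computes it: `Σ_{n ≤ M/x} Λ(n)/(nL)·(h′(u;xn) − h′(u;x)) + Σ_{d ∣ x} Λ(d)/L·(h′(u;x/d) − h′(u;x))
− ∂_u h′(u;x) ≤ ε·h′(u;x)` for all `u > 0` and `1 ≤ x ≤ M`; conclusion `(e^{τ·walkGen M})_{11} ≤ e^{ετ}g(τ)`. -/
theorem returnProb_le_of_arith_generator_le {M : ℕ} (hM : 1 ≤ M) {τ ε : ℝ} (hτ : 0 < τ) (D : ℝ → ℕ → ℝ)
    (hD : ∀ u, 0 < u → ∀ x : St M, HasDerivAt (fun v => hPrime (Real.log M) v x) (D u x) u)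
    (hineq : ∀ u, 0 < u → ∀ x ∈ Finset.Icc 1 M,
      (∑ n ∈ Finset.Icc 1 (M / x), (Λ n : ℝ) / ((n : ℝ) * Real.log M) *
          (hPrime (Real.log M) u (x * n) - hPrime (Real.log M) u x)) +
        (∑ d ∈ x.divisors, (Λ d : ℝ) / Real.log M *
          (hPrime (Real.log M) u (x / d) - hPrime (Real.log M) u x)) - D u x
        ≤ ε * hPrime (Real.log M) u x) :
    (exp (τ • walkGen M)) (stOne hM) (stOne hM) ≤ Real.exp (ε * τ) * ccpg τ := by
  refine returnProb_le_of_generator_le hM hτ D hD fun u hu z => ?_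
  rw [walkGen_sum_eq_arith M (fun y => hPrime (Real.log M) u y) z]
  exact hineq u hu z z.2

/-- **THEOREM C♯, lower skeleton, arithmetic form** (with `h̃`). -/
theorem returnProb_ge_of_arith_generator_ge {M : ℕ} (hM : 1 ≤ M) {τ ε : ℝ} (hτ : 0 < τ) (D : ℝ → ℕ → ℝ)
    (hD : ∀ u, 0 < u → ∀ x : St M, HasDerivAt (fun v => hTilde (Real.log M) v x) (D u x) u)
    (hineq : ∀ u, 0 < u → ∀ x ∈ Finset.Icc 1 M,
      -(ε * hTilde (Real.log M) u x) ≤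
        (∑ n ∈ Finset.Icc 1 (M / x), (Λ n : ℝ) / ((n : ℝ) * Real.log M) *
            (hTilde (Real.log M) u (x * n) - hTilde (Real.log M) u x)) +
          (∑ d ∈ x.divisors, (Λ d : ℝ) / Real.log M *
            (hTilde (Real.log M) u (x / d) - hTilde (Real.log M) u x)) - D u x) :
    Real.exp (-(ε * τ)) * ccpg τ ≤ (exp (τ • walkGen M)) (stOne hM) (stOne hM) := by
  refine returnProb_ge_of_generator_ge hM hτ D hD fun u hu z => ?_
  rw [walkGen_sum_eq_arith M (fun y => hTilde (Real.log M) u y) z]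
  exact hineq u hu z z.2

/-! ## With the explicit derivatives: only the generator inequality remains -/

/-- **THEOREM C♯'s upper half, modulo 16.4–16.5**: if for all `u > 0` and `1 ≤ x ≤ M`
`Σ_{n≤M/x}Λ(n)/(nL)(h′(u;xn) − h′(u;x)) + Σ_{d∣x}Λ(d)/L(h′(u;x/d) − h′(u;x)) − ∂_uh′(u;x) ≤ ε·h′(u;x)` (with
the explicit `∂_uh′ = hPrimeDeriv`), then `(e^{τ·walkGen M})_{11} ≤ e^{ετ}g(τ)` for every `τ > 0`.  With
`ε = ε⁺_L` of 16.5 this is THEOREM C♯'s upper bound `p⁰₁₁(τ/L) ≤ g(τ)e^{ε⁺_Lτ}`. -/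
theorem returnProb_le_of_sixteen_four {M : ℕ} (hM : 1 ≤ M) {τ ε : ℝ} (hτ : 0 < τ)
    (hineq : ∀ u, 0 < u → ∀ x ∈ Finset.Icc 1 M,
      (∑ n ∈ Finset.Icc 1 (M / x), (Λ n : ℝ) / ((n : ℝ) * Real.log M) *
          (hPrime (Real.log M) u (x * n) - hPrime (Real.log M) u x)) +
        (∑ d ∈ x.divisors, (Λ d : ℝ) / Real.log M *
          (hPrime (Real.log M) u (x / d) - hPrime (Real.log M) u x)) - hPrimeDeriv (Real.log M) u x
        ≤ ε * hPrime (Real.log M) u x) :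
    (exp (τ • walkGen M)) (stOne hM) (stOne hM) ≤ Real.exp (ε * τ) * ccpg τ :=
  returnProb_le_of_arith_generator_le hM hτ (fun u x => hPrimeDeriv (Real.log M) u x)
    (fun _ hu x => hasDerivAt_hPrime (Real.log M) hu.ne' x) hineq

/-- **THEOREM C♯'s lower half, modulo 16.4–16.5** (with `h̃` and `∂_uh̃ = hTildeDeriv`):
`(e^{τ·walkGen M})_{11} ≥ e^{−ετ}g(τ)`. -/
theorem returnProb_ge_of_sixteen_four {M : ℕ} (hM : 1 ≤ M) {τ ε : ℝ} (hτ : 0 < τ)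
    (hineq : ∀ u, 0 < u → ∀ x ∈ Finset.Icc 1 M,
      -(ε * hTilde (Real.log M) u x) ≤
        (∑ n ∈ Finset.Icc 1 (M / x), (Λ n : ℝ) / ((n : ℝ) * Real.log M) *
            (hTilde (Real.log M) u (x * n) - hTilde (Real.log M) u x)) +
          (∑ d ∈ x.divisors, (Λ d : ℝ) / Real.log M *
            (hTilde (Real.log M) u (x / d) - hTilde (Real.log M) u x)) - hTildeDeriv (Real.log M) u x) :
    Real.exp (-(ε * τ)) * ccpg τ ≤ (exp (τ • walkGen M)) (stOne hM) (stOne hM) :=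
  returnProb_ge_of_arith_generator_ge hM hτ (fun u x => hTildeDeriv (Real.log M) u x)
    (fun _ hu x => hasDerivAt_hTilde (Real.log M) hu.ne' x) hineq

end Summit.RiemannHypothesis.RiemannHypothesis.Theorems.IntegerScrew

end
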